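import Mathlib
import Summits.NavierStokesRegularity.FluidComputer.AbcLatticeEigenSynthesis
import HarnessLib

/-!
# Locality (F3) of the ABC lattice operator in Cartesian form: six-neighbour support propagation,
# head/tail decoupling across one sup-norm shell (ASSEMBLY notes (A2) band / (A4) cross term of
# `HOME/instab4/KERNEL-CHAIN.md`; instab4 g5 — implementation 2 of the X0 chain, cell `ns-blowup`,
# 2026-08-26)

HONEST FRAMING (human ruling D-0035): nothing here is a claim about Navier–Stokes blow-up.
WHAT THIS IS NOT: not NS evidence; MODEL lane (linearisation of forced Navier–Stokes about the exact
steady ABC state; certifier units `L_R = −(1/R)|k|² + Π X`,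
`X c(k) = Σ_{s∈{±e_j}} Û(s) × (i(k−s) × c(k−s) − c(k−s))`). No certificate is moved by this file.
SKEWCUT-CERT §3 (F3) / cert.py's block structure: the first-order part `X` couples a frequency `k`
only to its six neighbours `k ∓ e_j`, so in the sup-norm cube filtration (head = cube `K`, shell
`K+1`, tail beyond) the HEAD talks to the TAIL only through the shell `K+1` — the reason the
certificates' CROSS TERM lives on one shell (`Q_K = C_K N_K B_K`) and the tail test is a scalar.
Here, with supports phrased through hypotheses (no definitions):

* §1 `crossForm_eq_zero_of_neighbours` — `X c(k) = 0` if `c` vanishes at the six neighbours of `k`.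
* §2 `crossForm_eq_zero_outside_of_head` — `c` supported in the cube `‖m‖_∞ ≤ K` ⇒ `X c(k) = 0`
  whenever some `|k_j| ≥ K + 2`; `crossForm_eq_zero_inside_of_tail` — `c` supported where some
  `|m_j| ≥ K + 1` ⇒ `X c(k) = 0` whenever all `|k_j| + 2 ≤ K + 1` (i.e. `‖k‖_∞ ≤ K − 1`).
* §3 `inner_tail_crossForm_head_eq_zero` — for `t` supported outside the cube `K` and `d` inside it,
  `⟪t(k), X d(k)⟫ = 0` unless `‖k‖_∞ = K + 1`: the head–tail coupling is carried by ONE shell.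

Mathlib + the files named; no new definitions, no named facts.
-/

noncomputable section

open scoped BigOperators ComplexConjugate Matrix
open Filter Set Function MeasureTheory UnitAddTorus

namespace Summit.NavierStokesRegularity.FluidComputer.AbcLatticeLocality

open Literature.Analysis.FunctionSpaces Literature.Analysis.FunctionSpaces.Torus
open Literature.Analysis.FunctionSpaces.EuclideanSpace
open Literature.Analysis.FluidPDE Literature.Analysis.FluidPDE.ScalarFourier
open Literature.Analysis.FluidPDE.SteadyLattice
open AbcLatticeEigenSynthesis

/-! ## §1 Six-neighbour locality -/

/-- **(F3) locality**: `X c(k)` depends on `c` only through the six neighbours `c(k − s)`, `s = ±e_j`;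
in particular it vanishes when they all do (any `A, B, C`). -/
theorem crossForm_eq_zero_of_neighbours (A B C : ℝ) (c : (Fin 3 → ℤ) → EuclideanSpace ℂ (Fin 3))
    (k : Fin 3 → ℤ) (h : ∀ s ∈ Torus.abcFreq, c (k - s) = 0) :
    (∑ s ∈ Torus.abcFreq, (WithLp.toLp 2 (crossProduct (WithLp.ofLp (Torus.abcCoeff A B C s))
        (Complex.I • crossProduct (fun j => (((k - s) j : ℤ) : ℂ)) (WithLp.ofLp (c (k - s))) -
          WithLp.ofLp (c (k - s)))) : EuclideanSpace ℂ (Fin 3))) = 0 := by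
  refine Finset.sum_eq_zero fun s hs => ?_
  rw [h s hs]
  simp

/-- A neighbour of `k` along the shell differs from `k` by at most one in each coordinate:
`|k_j| ≤ |(k − s)_j| + 1` and `|(k − s)_j| ≤ |k_j| + 1` for `s ∈ {±e_i}`. [folklore] -/
theorem abs_sub_abcFreq_bounds (k : Fin 3 → ℤ) {s : Fin 3 → ℤ} (hs : s ∈ Torus.abcFreq) (j : Fin 3) :
    |k j| ≤ |(k - s) j| + 1 ∧ |(k - s) j| ≤ |k j| + 1 := by
  obtain ⟨⟨i, b⟩, rfl⟩ := Torus.mem_abcFreq.mp hs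
  have hsj : |Torus.abcDir (i, b) j| ≤ 1 := by
    rw [Torus.abcDir_apply]
    split_ifs <;> simp
  rw [Pi.sub_apply]
  constructor
  · have := abs_sub_abs_le_abs_sub (k j) (k j - Torus.abcDir (i, b) j)
    rw [sub_sub_cancel] at this
    linarith
  · have := abs_sub (k j) (Torus.abcDir (i, b) j)
    linarith

/-! ## §2 Support propagation across one sup-norm shell -/

/-- **Head ⇒ at most one shell further.** If `c` is supported in the sup-norm cube `K`
(`c(m) ≠ 0 ⇒ |m_j| ≤ K ∀ j`), then `X c(k) = 0` at every `k` with some `|k_j| ≥ K + 2`. -/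
theorem crossForm_eq_zero_outside_of_head (A B C : ℝ) (K : ℤ)
    (c : (Fin 3 → ℤ) → EuclideanSpace ℂ (Fin 3)) (hc : ∀ m, c m ≠ 0 → ∀ j, |m j| ≤ K)
    (k : Fin 3 → ℤ) (hk : ∃ j, K + 2 ≤ |k j|) :
    (∑ s ∈ Torus.abcFreq, (WithLp.toLp 2 (crossProduct (WithLp.ofLp (Torus.abcCoeff A B C s))
        (Complex.I • crossProduct (fun j => (((k - s) j : ℤ) : ℂ)) (WithLp.ofLp (c (k - s))) -
          WithLp.ofLp (c (k - s)))) : EuclideanSpace ℂ (Fin 3))) = 0 := by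
  refine crossForm_eq_zero_of_neighbours A B C c k fun s hs => ?_
  by_contra hne
  obtain ⟨j, hj⟩ := hk
  have h1 := (abs_sub_abcFreq_bounds k hs j).1
  have h2 := hc _ hne j
  linarith

/-- **Tail ⇒ at most one shell inward.** If `c` is supported outside the sup-norm cube `K`
(`c(m) ≠ 0 ⇒ ∃ j, K + 1 ≤ |m_j|`), then `X c(k) = 0` at every `k` with `|k_j| + 2 ≤ K + 1` for all `j`
(i.e. `‖k‖_∞ ≤ K − 1`). -/
theorem crossForm_eq_zero_inside_of_tail (A B C : ℝ) (K : ℤ)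
    (c : (Fin 3 → ℤ) → EuclideanSpace ℂ (Fin 3)) (hc : ∀ m, c m ≠ 0 → ∃ j, K + 1 ≤ |m j|)
    (k : Fin 3 → ℤ) (hk : ∀ j, |k j| + 2 ≤ K + 1) :
    (∑ s ∈ Torus.abcFreq, (WithLp.toLp 2 (crossProduct (WithLp.ofLp (Torus.abcCoeff A B C s))
        (Complex.I • crossProduct (fun j => (((k - s) j : ℤ) : ℂ)) (WithLp.ofLp (c (k - s))) -
          WithLp.ofLp (c (k - s)))) : EuclideanSpace ℂ (Fin 3))) = 0 := by
  refine crossForm_eq_zero_of_neighbours A B C c k fun s hs => ?_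
  by_contra hne
  obtain ⟨j, hj⟩ := hc _ hne
  have h1 := (abs_sub_abcFreq_bounds k hs j).2
  have h2 := hk j
  linarith

/-! ## §3 Head–tail coupling lives on the shell `K + 1` -/

/-- **The cross term is carried by one shell.** If `t` is supported outside the cube `K` and `d`
inside it, then `⟪t(k), X d(k)⟫ = 0` at every `k` off the shell `‖k‖_∞ = K + 1`, i.e. whenever
`(∀ j, |k_j| ≤ K) ∨ (∃ j, K + 2 ≤ |k_j|)`. (The symmetric statement `⟪d(k), X t(k)⟫ = 0` off the shell
`‖k‖_∞ = K` follows from `crossForm_eq_zero_inside_of_tail` in the same way.) -/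
theorem inner_tail_crossForm_head_eq_zero (A B C : ℝ) (K : ℤ)
    (t d : (Fin 3 → ℤ) → EuclideanSpace ℂ (Fin 3)) (ht : ∀ m, t m ≠ 0 → ∃ j, K + 1 ≤ |m j|)
    (hd : ∀ m, d m ≠ 0 → ∀ j, |m j| ≤ K) (k : Fin 3 → ℤ)
    (hk : (∀ j, |k j| ≤ K) ∨ (∃ j, K + 2 ≤ |k j|)) :
    (inner ℂ (t k) (∑ s ∈ Torus.abcFreq, (WithLp.toLp 2 (crossProduct (WithLp.ofLp (Torus.abcCoeff A B C s))
        (Complex.I • crossProduct (fun j => (((k - s) j : ℤ) : ℂ)) (WithLp.ofLp (d (k - s))) -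
          WithLp.ofLp (d (k - s)))) : EuclideanSpace ℂ (Fin 3))) : ℂ) = 0 := by
  rcases hk with hin | hout
  · -- `k` in the head: `t(k) = 0`
    have htk : t k = 0 := by
      by_contra hne
      obtain ⟨j, hj⟩ := ht k hne
      have := hin j
      linarith
    rw [htk, inner_zero_left]
  · rw [crossForm_eq_zero_outside_of_head A B C K d hd k hout, inner_zero_right]

/-- **Symmetric statement**: with `t`, `d` as above, `⟪d(k), X t(k)⟫ = 0` at every `k` off the shell
`‖k‖_∞ = K`, i.e. whenever `(∀ j, |k_j| + 2 ≤ K + 1) ∨ (∃ j, K + 1 ≤ |k_j|)`. -/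
theorem inner_head_crossForm_tail_eq_zero (A B C : ℝ) (K : ℤ)
    (t d : (Fin 3 → ℤ) → EuclideanSpace ℂ (Fin 3)) (ht : ∀ m, t m ≠ 0 → ∃ j, K + 1 ≤ |m j|)
    (hd : ∀ m, d m ≠ 0 → ∀ j, |m j| ≤ K) (k : Fin 3 → ℤ)
    (hk : (∀ j, |k j| + 2 ≤ K + 1) ∨ (∃ j, K + 1 ≤ |k j|)) :
    (inner ℂ (d k) (∑ s ∈ Torus.abcFreq, (WithLp.toLp 2 (crossProduct (WithLp.ofLp (Torus.abcCoeff A B C s))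
        (Complex.I • crossProduct (fun j => (((k - s) j : ℤ) : ℂ)) (WithLp.ofLp (t (k - s))) -
          WithLp.ofLp (t (k - s)))) : EuclideanSpace ℂ (Fin 3))) : ℂ) = 0 := by
  rcases hk with hin | hout
  · rw [crossForm_eq_zero_inside_of_tail A B C K t ht k hin, inner_zero_right]
  · -- `k` in the tail: `d(k) = 0`
    have hdk : d k = 0 := by
      by_contra hne
      obtain ⟨j, hj⟩ := hout
      have := hd k hne j
      linarith
    rw [hdk, inner_zero_left]

end Summit.NavierStokesRegularity.FluidComputer.AbcLatticeLocality

end
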